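import Literature.Topology.FourManifolds.CircleTubeTransition
import Mathlib.Analysis.Normed.Module.Normalize
import HarnessLib

/-!
# Shrinking a tube around a circle radially: the hypotheses of the uniqueness theorem are preserved and
# the target becomes small
(node T3c-1 `node_belt_isotopic_pushoff` of the sub-goal T3 of stub `stub_steinRealisation` (NF6), line
`modp-braid-orbits`, crux `ConvexBisection.AcyclicBisectionExists`, item stmt-SmoothPoincare4-10508;
wave 3, worker Z5, lead c5; convenience for stage (3c): the tube comparison `helper_belt_tubeComparison`
asks for a second tube with SMALL target)

For a tube `Φ : CircleTube Y` (`CircleTubeTransition.lean`) and `0 < κ ≤ 1` the radially shrunk tube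
**`shrinkTube Φ κ`**: `(θ, w) ↦ Φ (θ, κ w)` on the unit tube (§1).  Against a first tube `Φ₁` with the same core:

* §2 the core is unchanged; the transition map becomes `(ξ, κ⁻¹ ·) ∘ τ`, so the fibre derivative is `κ⁻¹ A(x)`
  (`fibreDeriv_shrinkTube`), the rotation field `frameVec` is UNCHANGED (`frameVec_shrinkTube`) and the orientation
  function is multiplied by `κ⁻¹ > 0` (`frameSign_shrinkTube`) — the hypotheses `hcore`, `hs`, `hsgn`, `hang` of
  `CircleTube.exists_diffeotopy_reflect` pass from `(Φ₁, Φ)` to `(Φ₁, shrinkTube Φ κ)`;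
* §3 the target of `shrinkTube Φ κ` lies in `Φ (𝕊¹ × B(0, κ))`, hence inside any neighbourhood of the core for `κ`
  small (`exists_shrinkTube_target_subset`; tube lemma);
* §4 registered helper `helper_belt_tubeShrink`.

Everything is proved; no named facts.

## References
* A. A. Kosinski, *Differential Manifolds*, Academic Press (1993), III (3.1). [Kosinski1993]
-/

noncomputable section

-- the prescribed namespace `Summit.<P>.<Sub>.…` duplicates `SmoothPoincare4` (P = Sub)
set_option linter.dupNamespace false

open scoped Manifold ContDiff Topology RealInnerProductSpace
open Set Function Metric Filter

namespace Summit.SmoothPoincare4.SmoothPoincare4.Theorems.AcyclicBisectionExists.ModpBraidOrbits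

open Literature.Topology.FourManifolds

/-! ### §1 The shrunk tube -/

section Shrink

variable {Y : Type*} [TopologicalSpace Y] [ChartedSpace (EuclideanSpace ℝ (Fin 3)) Y]

/-- The fibre scaling `(θ, w) ↦ (θ, κ w)` of `𝕊¹ × ℝ²` (`κ ≠ 0`), as a homeomorphism. [folklore] -/
def fibreScale (κ : ℝ) (hκ : κ ≠ 0) :
    ((sphere (0 : EuclideanSpace ℝ (Fin 2)) 1) × EuclideanSpace ℝ (Fin 2)) ≃ₜ
      ((sphere (0 : EuclideanSpace ℝ (Fin 2)) 1) × EuclideanSpace ℝ (Fin 2)) :=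
  (Homeomorph.refl _).prodCongr (Homeomorph.smulOfNeZero κ hκ)

/-- The fibre scaling on points. [folklore] -/
@[simp] theorem fibreScale_apply (κ : ℝ) (hκ : κ ≠ 0) (q : (sphere (0 : EuclideanSpace ℝ (Fin 2)) 1) × EuclideanSpace ℝ (Fin 2)) :
    fibreScale κ hκ q = (q.1, κ • q.2) := rfl

/-- The inverse fibre scaling on points. [folklore] -/
@[simp] theorem fibreScale_symm_apply (κ : ℝ) (hκ : κ ≠ 0) (q : (sphere (0 : EuclideanSpace ℝ (Fin 2)) 1) × EuclideanSpace ℝ (Fin 2)) :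
    (fibreScale κ hκ).symm q = (q.1, κ⁻¹ • q.2) := by
  simp [fibreScale, Homeomorph.smulOfNeZero_symm_apply, Prod.map]

/-- The image of the unit tube under the fibre scaling is the `κ`-tube (`κ > 0`). [folklore] -/
theorem fibreScale_image {κ : ℝ} (hκ : 0 < κ) :
    fibreScale κ hκ.ne' '' ((univ : Set (sphere (0 : EuclideanSpace ℝ (Fin 2)) 1)) ×ˢ ball (0 : EuclideanSpace ℝ (Fin 2)) 1) =
      (univ : Set (sphere (0 : EuclideanSpace ℝ (Fin 2)) 1)) ×ˢ ball (0 : EuclideanSpace ℝ (Fin 2)) κ := by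
  ext ⟨θ, w⟩
  simp only [mem_image, mem_prod, mem_univ, true_and, mem_ball_zero_iff, fibreScale_apply, Prod.mk.injEq]
  constructor
  · rintro ⟨⟨θ', w'⟩, hw', rfl, rfl⟩
    rw [norm_smul, Real.norm_eq_abs, abs_of_pos hκ]
    nlinarith
  · intro hw
    refine ⟨(θ, κ⁻¹ • w), ?_, rfl, ?_⟩
    · rw [norm_smul, norm_inv, Real.norm_eq_abs, abs_of_pos hκ]
      rw [inv_mul_lt_iff₀ hκ]; linarith
    · rw [smul_smul, mul_inv_cancel₀ hκ.ne', one_smul]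

/-- The fibre scaling as a partial homeomorphism from the unit tube onto the `κ`-tube. [folklore] -/
def fibreScalePH (κ : ℝ) (hκ : 0 < κ) :
    OpenPartialHomeomorph ((sphere (0 : EuclideanSpace ℝ (Fin 2)) 1) × EuclideanSpace ℝ (Fin 2))
      ((sphere (0 : EuclideanSpace ℝ (Fin 2)) 1) × EuclideanSpace ℝ (Fin 2)) :=
  (fibreScale κ hκ.ne').toOpenPartialHomeomorphOfImageEq
    ((univ : Set (sphere (0 : EuclideanSpace ℝ (Fin 2)) 1)) ×ˢ ball (0 : EuclideanSpace ℝ (Fin 2)) 1)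
    (isOpen_univ.prod isOpen_ball) _ (fibreScale_image hκ)

variable (Φ : CircleTube Y) {κ : ℝ} (hκ : 0 < κ) (hκ1 : κ ≤ 1)

/-- The source of the scaling partial homeomorphism is the unit tube. [folklore] -/
theorem fibreScalePH_source (κ : ℝ) (hκ : 0 < κ) :
    (fibreScalePH κ hκ).source = (univ : Set (sphere (0 : EuclideanSpace ℝ (Fin 2)) 1)) ×ˢ ball (0 : EuclideanSpace ℝ (Fin 2)) 1 :=
  Homeomorph.toOpenPartialHomeomorphOfImageEq_source _ _ _ _ _

/-- The target of the scaling partial homeomorphism is the `κ`-tube. [folklore] -/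
theorem fibreScalePH_target (κ : ℝ) (hκ : 0 < κ) :
    (fibreScalePH κ hκ).target = (univ : Set (sphere (0 : EuclideanSpace ℝ (Fin 2)) 1)) ×ˢ ball (0 : EuclideanSpace ℝ (Fin 2)) κ :=
  Homeomorph.toOpenPartialHomeomorphOfImageEq_target _ _ _ _ _

/-- The scaling partial homeomorphism on points. [folklore] -/
theorem fibreScalePH_apply (κ : ℝ) (hκ : 0 < κ) (q : (sphere (0 : EuclideanSpace ℝ (Fin 2)) 1) × EuclideanSpace ℝ (Fin 2)) :
    fibreScalePH κ hκ q = (q.1, κ • q.2) := by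
  rw [fibreScalePH, Homeomorph.toOpenPartialHomeomorphOfImageEq_apply, fibreScale_apply]

/-- The inverse scaling partial homeomorphism on points. [folklore] -/
theorem fibreScalePH_symm_apply (κ : ℝ) (hκ : 0 < κ) (q : (sphere (0 : EuclideanSpace ℝ (Fin 2)) 1) × EuclideanSpace ℝ (Fin 2)) :
    (fibreScalePH κ hκ).symm q = (q.1, κ⁻¹ • q.2) := by
  rw [fibreScalePH, Homeomorph.toOpenPartialHomeomorphOfImageEq_symm_apply, fibreScale_symm_apply]

/-- The fibre scaling is smooth. [folklore] -/
theorem contMDiff_fibreScaleFun (c : ℝ) :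
    ContMDiff ((𝓡 1).prod 𝓘(ℝ, EuclideanSpace ℝ (Fin 2))) ((𝓡 1).prod 𝓘(ℝ, EuclideanSpace ℝ (Fin 2))) ∞
      fun q : (sphere (0 : EuclideanSpace ℝ (Fin 2)) 1) × EuclideanSpace ℝ (Fin 2) => ((q.1, c • q.2) :
        (sphere (0 : EuclideanSpace ℝ (Fin 2)) 1) × EuclideanSpace ℝ (Fin 2)) := by
  have h2 : ContMDiff ((𝓡 1).prod 𝓘(ℝ, EuclideanSpace ℝ (Fin 2))) 𝓘(ℝ, EuclideanSpace ℝ (Fin 2)) ∞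
      fun q : (sphere (0 : EuclideanSpace ℝ (Fin 2)) 1) × EuclideanSpace ℝ (Fin 2) => q.2 := contMDiff_snd
  have hc : ContMDiff ((𝓡 1).prod 𝓘(ℝ, EuclideanSpace ℝ (Fin 2))) 𝓘(ℝ, ℝ) ∞
      fun _ : (sphere (0 : EuclideanSpace ℝ (Fin 2)) 1) × EuclideanSpace ℝ (Fin 2) => c := contMDiff_const
  exact contMDiff_fst.prodMk (hc.smul h2)

/-- **The radially shrunk tube `(θ, w) ↦ Φ (θ, κ w)`** (`0 < κ ≤ 1`). [cite: Kosinski1993, III (3.1)] -/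
def shrinkTube : CircleTube Y where
  toHomeo := (fibreScalePH κ hκ).trans Φ.toHomeo
  source_eq := by
    have hκ1' : κ ≤ 1 := hκ1
    rw [OpenPartialHomeomorph.trans_source, fibreScalePH_source]
    ext ⟨θ, w⟩
    constructor
    · exact fun h => h.1
    · intro hw
      refine ⟨hw, ?_⟩
      show fibreScalePH κ hκ (θ, w) ∈ Φ.toHomeo.source
      rw [fibreScalePH_apply]
      have hw' : ‖w‖ < 1 := by simpa using hw
      refine Φ.mem_source_iff.2 ?_
      rw [norm_smul, Real.norm_eq_abs, abs_of_pos hκ]; nlinarith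
  contMDiffOn_toHomeo := by
    rw [OpenPartialHomeomorph.coe_trans]
    refine Φ.contMDiffOn_toHomeo.comp ?_ fun q hq => ?_
    · have e : ⇑(fibreScalePH κ hκ) = fun q => (q.1, κ • q.2) := funext (fibreScalePH_apply κ hκ)
      rw [e]
      exact (contMDiff_fibreScaleFun κ).contMDiffOn
    · rw [OpenPartialHomeomorph.trans_source] at hq
      exact hq.2
  contMDiffOn_symm := by
    rw [OpenPartialHomeomorph.coe_trans_symm]
    have hsc : ContMDiff ((𝓡 1).prod 𝓘(ℝ, EuclideanSpace ℝ (Fin 2))) ((𝓡 1).prod 𝓘(ℝ, EuclideanSpace ℝ (Fin 2))) ∞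
        (fibreScalePH κ hκ).symm := by
      have e : ⇑(fibreScalePH κ hκ).symm = fun q => (q.1, κ⁻¹ • q.2) := funext (fibreScalePH_symm_apply κ hκ)
      rw [e]
      exact contMDiff_fibreScaleFun κ⁻¹
    refine hsc.comp_contMDiffOn (Φ.contMDiffOn_symm.mono fun y hy => ?_)
    rw [OpenPartialHomeomorph.trans_target] at hy
    exact hy.1

/-- The shrunk tube on points: `shrinkTube Φ κ (θ, w) = Φ (θ, κ w)`. [folklore] -/
@[simp] theorem shrinkTube_apply (q : (sphere (0 : EuclideanSpace ℝ (Fin 2)) 1) × EuclideanSpace ℝ (Fin 2)) :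
    (shrinkTube Φ hκ hκ1).toHomeo q = Φ.toHomeo (q.1, κ • q.2) := rfl

/-- The inverse of the shrunk tube on points: `(θ, κ⁻¹ w)` for `Φ⁻¹ y = (θ, w)`. [folklore] -/
@[simp] theorem shrinkTube_symm_apply (y : Y) :
    (shrinkTube Φ hκ hκ1).toHomeo.symm y = ((Φ.toHomeo.symm y).1, κ⁻¹ • (Φ.toHomeo.symm y).2) := by
  show (fibreScalePH κ hκ).symm (Φ.toHomeo.symm y) = _
  rw [fibreScalePH_symm_apply]

/-- The target of the shrunk tube lies in `Φ (𝕊¹ × B(0, κ))`. [folklore] -/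
theorem shrinkTube_target_subset :
    (shrinkTube Φ hκ hκ1).toHomeo.target ⊆ Φ.toHomeo ''
      ((univ : Set (sphere (0 : EuclideanSpace ℝ (Fin 2)) 1)) ×ˢ ball (0 : EuclideanSpace ℝ (Fin 2)) κ) := by
  intro y hy
  have hy' : y ∈ ((fibreScalePH κ hκ).trans Φ.toHomeo).target := hy
  rw [OpenPartialHomeomorph.trans_target] at hy'
  obtain ⟨hyt, hys⟩ := hy'
  refine ⟨Φ.toHomeo.symm y, ?_, Φ.apply_symm_apply hyt⟩
  have : Φ.toHomeo.symm y ∈ (fibreScalePH κ hκ).target := hys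
  rwa [fibreScalePH_target] at this

/-! ### §2 Core, transition map, fibre derivative, frame of the shrunk tube -/

/-- The core is unchanged. [folklore] -/
theorem shrinkTube_core (θ : sphere (0 : EuclideanSpace ℝ (Fin 2)) 1) : (shrinkTube Φ hκ hκ1).core θ = Φ.core θ := by
  rw [CircleTube.core_apply, CircleTube.core_apply, shrinkTube_apply, smul_zero]

variable (Φ₁ : CircleTube Y)

/-- **The transition map to the shrunk tube is the old one followed by `(ξ, κ⁻¹ ·)`.** [folklore] -/
theorem transition_shrinkTube (q : (sphere (0 : EuclideanSpace ℝ (Fin 2)) 1) × EuclideanSpace ℝ (Fin 2)) :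
    CircleTube.transition Φ₁ (shrinkTube Φ hκ hκ1) q =
      ((CircleTube.transition Φ₁ Φ q).1, κ⁻¹ • (CircleTube.transition Φ₁ Φ q).2) := by
  simp only [CircleTube.transition, comp_apply, shrinkTube_symm_apply]

variable {Φ Φ₁} (hcore : ∀ θ, Φ₁.core θ = Φ.core θ)

include hcore in
/-- The shrunk tube has the core of `Φ₁` as well. [folklore] -/
theorem core_eq_shrinkTube (θ : sphere (0 : EuclideanSpace ℝ (Fin 2)) 1) : Φ₁.core θ = (shrinkTube Φ hκ hκ1).core θ := by
  rw [shrinkTube_core, hcore]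

include hcore in
/-- **The fibre derivative of the transition to the shrunk tube is `κ⁻¹ A(x)`.** [folklore] -/
theorem fibreDeriv_shrinkTube (x : sphere (0 : EuclideanSpace ℝ (Fin 2)) 1) :
    CircleTube.fibreDeriv Φ₁ (shrinkTube Φ hκ hκ1) x = κ⁻¹ • CircleTube.fibreDeriv Φ₁ Φ x := by
  unfold CircleTube.fibreDeriv
  have e : (fun w : EuclideanSpace ℝ (Fin 2) => (CircleTube.transition Φ₁ (shrinkTube Φ hκ hκ1) (x, w)).2) =
      fun w => κ⁻¹ • (CircleTube.transition Φ₁ Φ (x, w)).2 := by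
    funext w; rw [transition_shrinkTube]
  rw [e]
  have hd : DifferentiableAt ℝ (fun w : EuclideanSpace ℝ (Fin 2) => (CircleTube.transition Φ₁ Φ (x, w)).2) 0 := by
    have h1 : ContMDiffAt 𝓘(ℝ, EuclideanSpace ℝ (Fin 2)) 𝓘(ℝ, EuclideanSpace ℝ (Fin 2)) ∞
        (fun w : EuclideanSpace ℝ (Fin 2) => (CircleTube.transition Φ₁ Φ (x, w)).2) 0 := by
      have h2 : ContMDiffAt 𝓘(ℝ, EuclideanSpace ℝ (Fin 2)) ((𝓡 1).prod 𝓘(ℝ, EuclideanSpace ℝ (Fin 2))) ∞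
          (fun w : EuclideanSpace ℝ (Fin 2) => CircleTube.transition Φ₁ Φ (x, w)) 0 :=
        (CircleTube.contMDiffAt_transition (CircleTube.mem_transitionDom_zero hcore x)).comp 0
          (contMDiffAt_const.prodMk contMDiffAt_id)
      exact contMDiffAt_snd.comp 0 h2
    exact (h1.contDiffAt.differentiableAt (by simp))
  exact fderiv_const_smul hd κ⁻¹

include hcore in
/-- The first column scales: `κ⁻¹ A(x) e₀`. [folklore] -/
theorem frameCol_shrinkTube (x : sphere (0 : EuclideanSpace ℝ (Fin 2)) 1) :
    CircleTube.frameCol Φ₁ (shrinkTube Φ hκ hκ1) x = κ⁻¹ • CircleTube.frameCol Φ₁ Φ x := by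
  unfold CircleTube.frameCol
  rw [fibreDeriv_shrinkTube hκ hκ1 hcore x]
  rfl

include hcore in
/-- **The rotation field is unchanged by shrinking.** [folklore] -/
theorem frameVec_shrinkTube (x : sphere (0 : EuclideanSpace ℝ (Fin 2)) 1) :
    CircleTube.frameVec Φ₁ (shrinkTube Φ hκ hκ1) x = CircleTube.frameVec Φ₁ Φ x := by
  unfold CircleTube.frameVec
  rw [frameCol_shrinkTube hκ hκ1 hcore x, NormedSpace.normalize_smul_of_pos (inv_pos.2 hκ)]

include hcore in
/-- **The orientation function is multiplied by `κ⁻¹ > 0`.** [folklore] -/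
theorem frameSign_shrinkTube (x : sphere (0 : EuclideanSpace ℝ (Fin 2)) 1) :
    CircleTube.frameSign Φ₁ (shrinkTube Φ hκ hκ1) x = κ⁻¹ * CircleTube.frameSign Φ₁ Φ x := by
  unfold CircleTube.frameSign
  rw [frameVec_shrinkTube hκ hκ1 hcore x, fibreDeriv_shrinkTube hκ hκ1 hcore x]
  show ⟪κ⁻¹ • CircleTube.fibreDeriv Φ₁ Φ x planeE1, _⟫ = _
  rw [real_inner_smul_left]

include hcore in
/-- The sign condition passes to the shrunk tube. [folklore] -/
theorem frameSign_shrinkTube_pos {s : ℝ} (hsgn : ∀ x, 0 < s * CircleTube.frameSign Φ₁ Φ x)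
    (x : sphere (0 : EuclideanSpace ℝ (Fin 2)) 1) : 0 < s * CircleTube.frameSign Φ₁ (shrinkTube Φ hκ hκ1) x := by
  rw [frameSign_shrinkTube hκ hκ1 hcore x, mul_left_comm]
  exact mul_pos (inv_pos.2 hκ) (hsgn x)

/-! ### §3 Small targets -/

/-- **Shrunk tubes have small targets**: for every open `O ⊇ core` there is `κ ∈ (0, 1]` with the target of
`shrinkTube Φ κ` inside `O` (tube lemma around the compact zero section). [folklore] -/
theorem exists_shrinkTube_target_subset {O : Set Y} (hO : IsOpen O) (hcO : ∀ θ, Φ.core θ ∈ O) :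
    ∃ (κ : ℝ) (hκ : 0 < κ) (hκ1 : κ ≤ 1), (shrinkTube Φ hκ hκ1).toHomeo.target ⊆ O := by
  set V : Set ((sphere (0 : EuclideanSpace ℝ (Fin 2)) 1) × EuclideanSpace ℝ (Fin 2)) :=
    Φ.toHomeo.source ∩ Φ.toHomeo ⁻¹' O with hV
  have hVopen : IsOpen V := Φ.toHomeo.continuousOn.isOpen_inter_preimage Φ.isOpen_source hO
  have hsub : (univ : Set (sphere (0 : EuclideanSpace ℝ (Fin 2)) 1)) ×ˢ ({0} : Set (EuclideanSpace ℝ (Fin 2))) ⊆ V := by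
    rintro ⟨x, w⟩ ⟨-, hw⟩
    rw [mem_singleton_iff] at hw
    subst hw
    exact ⟨Φ.mem_source_zero x, hcO x⟩
  obtain ⟨u₀, v₀, -, hv₀, hu₀, h0v₀, huv⟩ :=
    generalized_tube_lemma isCompact_univ isCompact_singleton hVopen hsub
  obtain ⟨r, hr, hrv⟩ := Metric.isOpen_iff.1 hv₀ 0 (h0v₀ rfl)
  refine ⟨min r 1, lt_min hr one_pos, min_le_right _ _, fun y hy => ?_⟩
  obtain ⟨q, ⟨-, hq⟩, rfl⟩ := shrinkTube_target_subset Φ (lt_min hr one_pos) (min_le_right _ _) hy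
  have hqV : q ∈ V := huv ⟨hu₀ (mem_univ q.1), hrv (ball_subset_ball (min_le_left _ _) hq)⟩
  exact hqV.2

end Shrink

/-! ### §4 Registered helper -/

/-- **Registered helper `helper_belt_tubeShrink` (node T3c-1 of NF6 `stub_steinRealisation`, convenience
for stage (3c), wave 3, lead c5): radially shrinking a tube around a circle (`(θ, w) ↦ Φ (θ, κ w)`) keeps the
core and the rotation field of the transition from a first tube, multiplies the orientation function by
`κ⁻¹ > 0`, and makes the target as small as desired.** [cite: Kosinski1993, III (3.1)] -/
theorem helper_belt_tubeShrink :
    ∀ {Y : Type} [TopologicalSpace Y] [ChartedSpace (EuclideanSpace ℝ (Fin 3)) Y]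
      (Φ₁ Φ : Literature.Topology.FourManifolds.CircleTube Y) (_ : ∀ θ, Φ₁.core θ = Φ.core θ)
      (O : Set Y), IsOpen O → (∀ θ, Φ.core θ ∈ O) →
      ∃ (κ : ℝ) (hκ : 0 < κ) (hκ1 : κ ≤ 1),
        (Summit.SmoothPoincare4.SmoothPoincare4.Theorems.AcyclicBisectionExists.ModpBraidOrbits.shrinkTube Φ hκ hκ1).toHomeo.target ⊆ O ∧
        (∀ q, (Summit.SmoothPoincare4.SmoothPoincare4.Theorems.AcyclicBisectionExists.ModpBraidOrbits.shrinkTube Φ hκ hκ1).toHomeo q =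
          Φ.toHomeo (q.1, κ • q.2)) ∧
        (∀ θ, Φ₁.core θ = (Summit.SmoothPoincare4.SmoothPoincare4.Theorems.AcyclicBisectionExists.ModpBraidOrbits.shrinkTube Φ hκ hκ1).core θ) ∧
        (∀ x, Literature.Topology.FourManifolds.CircleTube.frameVec Φ₁
            (Summit.SmoothPoincare4.SmoothPoincare4.Theorems.AcyclicBisectionExists.ModpBraidOrbits.shrinkTube Φ hκ hκ1) x =
          Literature.Topology.FourManifolds.CircleTube.frameVec Φ₁ Φ x) ∧
        (∀ x, Literature.Topology.FourManifolds.CircleTube.frameSign Φ₁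
            (Summit.SmoothPoincare4.SmoothPoincare4.Theorems.AcyclicBisectionExists.ModpBraidOrbits.shrinkTube Φ hκ hκ1) x =
          κ⁻¹ * Literature.Topology.FourManifolds.CircleTube.frameSign Φ₁ Φ x) := by
  intro Y _ _ Φ₁ Φ hcore O hO hcO
  obtain ⟨κ, hκ, hκ1, hsub⟩ := exists_shrinkTube_target_subset (Φ := Φ) hO hcO
  exact ⟨κ, hκ, hκ1, hsub, fun q => rfl, core_eq_shrinkTube hκ hκ1 hcore, frameVec_shrinkTube hκ hκ1 hcore,
    frameSign_shrinkTube hκ hκ1 hcore⟩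

end Summit.SmoothPoincare4.SmoothPoincare4.Theorems.AcyclicBisectionExists.ModpBraidOrbits

end
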